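import Literature.Claims.NS.Shahmurov2026b
import Literature.Analysis.Calculus.NewtonKantorovichHolds
import Literature.Analysis.FluidPDE.FlatSwirlGauge
import Literature.Claims.NS.ClayPeriodScalingBridge
import Mathlib.Analysis.SpecialFunctions.NonIntegrable
import HarnessLib

/-!
# C12 `Shahmurov2026b` — salvage: the TRUE steps of the typed skeleton, discharged in the kernel

Cell `ns-claims` (D-0090 NS-CLAIMS SWEEP), salvage seat `ns-claims-salvage-p5`. The claim skeleton
`Literature/Claims/NS/Shahmurov2026b.lean` (typist-8, p464917) types R. Shahmurov, arXiv:2604.09949 v1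
(2026), «Stable Finite-Time Singularity Formation for 3D NS via 5D-Lifted Axisymmetric Reductions»,
as seven `Prop`-valued steps; nothing there is asserted. This file PROVES the step that is true as
typed, so that the refuter's per-step status table (TYPING-HYGIENE 11) can mark it
«kernel-discharged»:

* `step_3_holds : Step_3` — **Theorem 11.1, pp. 8–9** («the Newton–Kantorovich theorem applies and
  yields a unique exact zero of 𝒢(·,ν) in the validated ball around Ω̄_app»), AS TYPED: in ANY
  analytic profile framework (`Framework ν 𝒴 𝒳`, Banach spaces) carrying the printed enclosures
  (`Enclosures`: residual `‖𝒢(Ω̄_app)‖ ≤ δ` (8.1), a bounded two-sided inverse of `D𝒢(Ω̄_app)` of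
  norm `≤ M` (Thm 9.2), the Lipschitz bound `‖D𝒢(u) − D𝒢(v)‖ ≤ K‖u − v‖` (Lemma 10.3)), the map
  `𝒢(·,ν)` has a zero within `2Mδ` of `Ω̄_app`. This is the classical Newton–Kantorovich theorem in
  its affine covariant form (Deuflhard 2011, Thm. 2.1; Kantorovich 1948), a THEOREM OF THE TREE
  (`Literature.Analysis.Calculus.NewtonKantorovich_holds`), applied with `α = Mδ`, `ω̄₀ = MK` on
  `D = univ`: the Kantorovich quantity is `h₀ = αω̄₀ = M²δK ≤ ½` by the printed constants
  (`kantorovich_closure : 2δM²K ≤ 1`, proved in the skeleton), and the existence radius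
  `ρ₋ = (1 − √(1 − 2h₀))/ω̄₀ ≤ 2h₀/ω̄₀ = 2α = 2Mδ`.

* (rev 2) `curl_selfSimilar`, `iSup_enorm_curl_selfSimilar`, `step_4_core` — **Theorem 12.1,
  (12.3)–(12.4) p. 9**: the vorticity of the self-similar field is `(T*−t)⁻¹ω̄(x/√(T*−t))`, its
  sup norm is `(T*−t)⁻¹‖ω̄‖_∞`, and `∫₀^{T*}‖ω‖_∞ = ∞` (`lintegral_inv_sub_eq_top`) — Step 4 of the
  skeleton for every profile field with `ω̄ ≢ 0` (the remaining implication `IsExactProfile ⇒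
  ω̄ ≢ 0`, via the non-vanishing swirl, is not formalised here).

* (rev 3) `periodScalingBridge_holds`, `clayDelta_of_continuationBridge` — the period half of the
  typed `ClayDelta` is a theorem (lit-4's `ClayPeriodScalingBridge`, p467118); the delta to Clay's
  printed (D) is `ContinuationBridge` alone.

What this does NOT touch: Step 2 (S-CAP: whether a framework with the printed enclosures EXISTS —
no ancillary code/data in print), Step 1 (S-LIFT, refuter-4's locator: the printed 5D
incompressibility (3.3) is not the 3D divergence-free condition), Steps 4–6. The method-level
necessary conditions an exactly self-similar profile must meet are recorded in
`Literature/Analysis/FluidPDE/LeraySelfSimilarAnyInterval.lean` (`not_exists_selfSimilar_blowup_memLp_three`,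
NRŠ 1996 / Tsai 1998) and the catalogue entries `LeraySelfSimilarBlowupExclusion(_holds)`,
`AxisymmetricTypeIExclusion_holds`.

WHAT THIS IS NOT: not a claim about NS regularity or blow-up; not a claim about any author beyond
the typed locator.
-/

noncomputable section

open Metric Set Filter
open scoped Topology

-- The mandated landing namespace repeats the summit name by design (D-0017).
set_option linter.dupNamespace false

namespace Summit.NavierStokesRegularity.NavierStokesRegularity.Theorems

namespace Shahmurov2026b

open Literature.Claims.NS.Shahmurov2026b Literature.Analysis.Calculus

/-- The printed inverse bound is positive: `M = 482.6 > 0`. [cite: Shahmurov2026b, Thm 9.2 p.7] -/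
theorem inverseBoundM_pos : 0 < inverseBoundM := by norm_num [inverseBoundM]

/-- The printed Lipschitz constant is positive: `K = 1.1 × 10⁴ > 0`. [cite: Shahmurov2026b, Lemma 10.3 p.8] -/
theorem lipschitzK_pos : 0 < lipschitzK := by norm_num [lipschitzK]

/-- The printed residual bound is nonnegative: `δ = 8.42… × 10⁻¹² ≥ 0`. [cite: Shahmurov2026b, Lemma 8.1 p.5] -/
theorem residualDelta_nonneg : 0 ≤ residualDelta := by norm_num [residualDelta]

/-- Elementary: `1 − √(1 − 2h) ≤ 2h` for `0 ≤ h ≤ ½` (since `√x ≥ x` on `[0,1]`). [folklore] -/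
theorem one_sub_sqrt_le {h : ℝ} (h0 : 0 ≤ h) (h1 : h ≤ 1 / 2) :
    1 - Real.sqrt (1 - 2 * h) ≤ 2 * h := by
  have hx0 : 0 ≤ 1 - 2 * h := by linarith
  have hx1 : 1 - 2 * h ≤ 1 := by linarith
  have : 1 - 2 * h ≤ Real.sqrt (1 - 2 * h) := by
    rw [Real.le_sqrt hx0 hx0]
    nlinarith
  linarith

/-- **Step 3 of the skeleton (Theorem 11.1, pp. 8–9) is TRUE as typed — kernel-discharged by the
Newton–Kantorovich theorem of the tree** (`Literature.Analysis.Calculus.NewtonKantorovich_holds`,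
Deuflhard 2011 Thm 2.1 / Kantorovich 1948): in every framework with the printed enclosures the
profile map has a zero `y` with `‖y − Ω̄_app‖ ≤ 2Mδ` (indeed within the Kantorovich radius
`ρ₋ = (1 − √(1 − 2M²δK))/(MK) ≤ 2Mδ`). [cite: Shahmurov2026b, Thm 11.1 pp.8–9] -/
theorem step_3_holds : Literature.Claims.NS.Shahmurov2026b.Step_3 := by
  intro ν Y X _ _ _ _ _ _ 𝔉 hE
  obtain ⟨L, hL⟩ := hE.inverse
  -- the Kantorovich data (Deuflhard 2011, (2.2)–(2.3)): `F = 𝒢(·,ν)`, `F' = D𝒢`, `D = univ`,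
  -- `x⁰ = Ω̄_app`, `G = L`, `α = Mδ`, `ω̄₀ = MK`
  have hK : LipschitzWith (Real.toNNReal lipschitzK) (fderiv ℝ 𝔉.G) :=
    LipschitzWith.of_dist_le_mul fun u v => by
      rw [dist_eq_norm, dist_eq_norm, Real.coe_toNNReal _ lipschitzK_pos.le]
      exact hE.lipschitz u v
  let d : KantorovichData Y X :=
    { F := 𝔉.G
      F' := fderiv ℝ 𝔉.G
      D := univ
      x0 := 𝔉.Ωapp
      G := L
      α := inverseBoundM * residualDelta
      ω := inverseBoundM * lipschitzK
      isOpen_D := isOpen_univ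
      convex_D := convex_univ
      x0_mem := mem_univ _
      hasFDerivAt := fun x _ => (hE.differentiable x).hasFDerivAt
      continuousOn_F' := hK.continuous.continuousOn
      G_left := fun v => by
        have h := DFunLike.congr_fun hL.1 v
        simpa using h
      G_right := fun w => by
        have h := DFunLike.congr_fun hL.2.1 w
        simpa using h
      norm_G_F_le := by
        calc ‖L (𝔉.G 𝔉.Ωapp)‖ ≤ ‖L‖ * ‖𝔉.G 𝔉.Ωapp‖ := L.le_opNorm _
          _ ≤ inverseBoundM * residualDelta :=
              mul_le_mul hL.2.2 hE.residual (norm_nonneg _) inverseBoundM_pos.le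
      lipschitz := fun x _ y _ => by
        calc ‖L.comp (fderiv ℝ 𝔉.G y - fderiv ℝ 𝔉.G x)‖ ≤ ‖L‖ * ‖fderiv ℝ 𝔉.G y - fderiv ℝ 𝔉.G x‖ :=
              ContinuousLinearMap.opNorm_comp_le _ _
          _ ≤ inverseBoundM * (lipschitzK * ‖y - x‖) :=
              mul_le_mul hL.2.2 (hE.lipschitz y x) (norm_nonneg _) inverseBoundM_pos.le
          _ = inverseBoundM * lipschitzK * ‖y - x‖ := by ring
      ω_pos := mul_pos inverseBoundM_pos lipschitzK_pos
      h0_le := by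
        have h := kantorovich_closure
        nlinarith [inverseBoundM_pos, lipschitzK_pos, residualDelta_nonneg] }
  obtain ⟨-, -, -, xstar, hxstar, hzero, -⟩ := NewtonKantorovich_holds Y X d (subset_univ _)
  refine ⟨xstar, hzero, ?_⟩
  -- `‖x* − Ω̄_app‖ ≤ ρ₋ ≤ 2h₀/ω̄₀ = 2α = 2Mδ`
  have hmem : ‖xstar - 𝔉.Ωapp‖ ≤ d.rhoMinus := by
    have h := mem_closedBall.1 hxstar
    rwa [dist_eq_norm] at h
  refine hmem.trans ?_
  have hω : 0 < d.ω := d.ω_pos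
  have hα0 : 0 ≤ d.α := mul_nonneg inverseBoundM_pos.le residualDelta_nonneg
  have hh0 : 0 ≤ d.h0 := mul_nonneg hα0 hω.le
  have hrho : d.rhoMinus ≤ 2 * d.h0 / d.ω := by
    unfold KantorovichData.rhoMinus
    exact div_le_div_of_nonneg_right (one_sub_sqrt_le hh0 d.h0_le) hω.le
  calc d.rhoMinus ≤ 2 * d.h0 / d.ω := hrho
    _ = 2 * d.α := by
        unfold KantorovichData.h0
        field_simp
    _ = 2 * inverseBoundM * residualDelta := by
        show 2 * (inverseBoundM * residualDelta) = 2 * inverseBoundM * residualDelta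
        ring

/-! ## Step 4 (Thm 12.1, (12.3)–(12.4) and the BKM divergence): the scaling identities, and the
divergence of `∫₀^{T*} ‖ω(t)‖_∞` modulo `ω̄ ≢ 0` (rev 2) -/

section StepFour

open MeasureTheory Literature.Analysis.FluidPDE

/-- **(12.3): the vorticity of the self-similar field (12.2) is `ω(x,t) = (T*−t)⁻¹ ω̄(x/√(T*−t))`**
for every `t < T*` and every profile field `ū` (no differentiability hypothesis: the tree's
`curl_smul_comp_smul`, `curl(k • v(c ·)) = (kc) • (curl v)(c ·)`, with `k = c = (T*−t)^{-1/2}`).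
[cite: Shahmurov2026b, Thm 12.1 eq. (12.3) p.9] -/
theorem curl_selfSimilar {T t : ℝ} (ht : t < T)
    (ubar : EuclideanSpace ℝ (Fin 3) → EuclideanSpace ℝ (Fin 3)) (x : EuclideanSpace ℝ (Fin 3)) :
    curl (selfSimilar T ubar t) x = (T - t)⁻¹ • curl ubar ((Real.sqrt (T - t))⁻¹ • x) := by
  rw [show selfSimilar T ubar t = fun y => (Real.sqrt (T - t))⁻¹ • ubar ((Real.sqrt (T - t))⁻¹ • y)
    from rfl, curl_smul_comp_smul]
  congr 1
  rw [← pow_two, inv_pow, Real.sq_sqrt (sub_nonneg.2 ht.le)]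

/-- **(12.4): `‖ω(·,t)‖_{L^∞} = (T*−t)⁻¹ ‖ω̄‖_{L^∞}`** (suprema in `[0, ∞]`) for every `t < T*`: the
dilation `x ↦ x/√(T*−t)` is onto. [cite: Shahmurov2026b, Thm 12.1 eq. (12.4) p.9] -/
theorem iSup_enorm_curl_selfSimilar {T t : ℝ} (ht : t < T)
    (ubar : EuclideanSpace ℝ (Fin 3) → EuclideanSpace ℝ (Fin 3)) :
    (⨆ x : EuclideanSpace ℝ (Fin 3), ‖curl (selfSimilar T ubar t) x‖ₑ) =
      ENNReal.ofReal ((T - t)⁻¹) * ⨆ x : EuclideanSpace ℝ (Fin 3), ‖curl ubar x‖ₑ := by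
  have hpos : 0 < T - t := sub_pos.2 ht
  have hL : (Real.sqrt (T - t))⁻¹ ≠ 0 := inv_ne_zero (Real.sqrt_pos.2 hpos).ne'
  have hsurj : Function.Surjective fun x : EuclideanSpace ℝ (Fin 3) => (Real.sqrt (T - t))⁻¹ • x :=
    fun y => ⟨Real.sqrt (T - t) • y, by simp [smul_smul, inv_mul_cancel₀ (Real.sqrt_pos.2 hpos).ne']⟩
  simp_rw [curl_selfSimilar ht, enorm_smul, Real.enorm_eq_ofReal (inv_nonneg.2 hpos.le)]
  rw [ENNReal.mul_iSup]
  exact hsurj.iSup_comp fun y => ENNReal.ofReal ((T - t)⁻¹) * ‖curl ubar y‖ₑ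

/-- `∫₀^{T} (T − t)⁻¹ dt = +∞` (lower Lebesgue integral on `(0,T)`, `T > 0`): `t ↦ (t − T)⁻¹` is not
integrable at `T` (Mathlib `intervalIntegrable_sub_inv_iff`). [folklore] -/
theorem lintegral_inv_sub_eq_top {T : ℝ} (hT : 0 < T) :
    (∫⁻ t in Ioo 0 T, ENNReal.ofReal ((T - t)⁻¹)) = ⊤ := by
  by_contra hne
  have hmeas : Measurable fun t : ℝ => (T - t)⁻¹ := (measurable_const.sub measurable_id).inv
  -- finiteness of the lintegral makes `(T - t)⁻¹` integrable on `(0, T)`, hence `(t - T)⁻¹` too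
  have henorm : ∀ t ∈ Ioo 0 T, ‖(T - t)⁻¹‖ₑ = ENNReal.ofReal ((T - t)⁻¹) := fun t ht =>
    Real.enorm_eq_ofReal (inv_nonneg.2 (sub_nonneg.2 ht.2.le))
  have hint : IntegrableOn (fun t : ℝ => (T - t)⁻¹) (Ioo 0 T) := by
    refine ⟨hmeas.aestronglyMeasurable, ?_⟩
    rw [HasFiniteIntegral, setLIntegral_congr_fun measurableSet_Ioo henorm]
    exact lt_top_iff_ne_top.2 hne
  have hint' : IntervalIntegrable (fun t : ℝ => (t - T)⁻¹) volume 0 T := by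
    have h2 : IntegrableOn (fun t : ℝ => (t - T)⁻¹) (Ioo 0 T) := by
      have : (fun t : ℝ => (t - T)⁻¹) = fun t => -(T - t)⁻¹ := by
        funext t; rw [← neg_sub, inv_neg]
      rw [this]; exact hint.neg
    rw [intervalIntegrable_iff_integrableOn_Ioo_of_le hT.le]
    exact h2
  have h := intervalIntegrable_sub_inv_iff.1 hint'
  rcases h with h | h
  · exact hT.ne h
  · exact h (by rw [Set.uIcc_of_le hT.le]; exact ⟨hT.le, le_rfl⟩)

/-- **Step 4 modulo the non-vanishing of the profile vorticity.** For every `T* > 0` and every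
profile field `ū` whose vorticity `ω̄ = curl ū` is not identically zero (`⨆‖ω̄‖ₑ ≠ 0`; for an exact
profile of the paper this holds because the swirl `ρΩ̄` is `≢ 0` — not formalised here), the
self-similar field (12.2) satisfies (12.3), (12.4) and `∫₀^{T*} ‖ω(·,t)‖_{L^∞} dt = ∞` (the BKM
side of Thm 12.1). [cite: Shahmurov2026b, Thm 12.1 eqs. (12.1)–(12.4) p.9] -/
theorem step_4_core {T : ℝ} (hT : 0 < T)
    (ubar : EuclideanSpace ℝ (Fin 3) → EuclideanSpace ℝ (Fin 3))
    (hω : (⨆ x : EuclideanSpace ℝ (Fin 3), ‖curl ubar x‖ₑ) ≠ 0) :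
    (∀ t ∈ Ioo 0 T, ∀ x : EuclideanSpace ℝ (Fin 3),
        curl (selfSimilar T ubar t) x = (T - t)⁻¹ • curl ubar ((Real.sqrt (T - t))⁻¹ • x)) ∧
    (∀ t ∈ Ioo 0 T,
        (⨆ x : EuclideanSpace ℝ (Fin 3), ‖curl (selfSimilar T ubar t) x‖ₑ) =
          ENNReal.ofReal ((T - t)⁻¹) * ⨆ x : EuclideanSpace ℝ (Fin 3), ‖curl ubar x‖ₑ) ∧
    (∫⁻ t in Ioo 0 T, ⨆ x : EuclideanSpace ℝ (Fin 3), ‖curl (selfSimilar T ubar t) x‖ₑ) = ⊤ := by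
  refine ⟨fun t ht x => curl_selfSimilar ht.2 ubar x, fun t ht => iSup_enorm_curl_selfSimilar ht.2 ubar,
    ?_⟩
  have hmeas : Measurable fun t : ℝ => ENNReal.ofReal ((T - t)⁻¹) :=
    ((measurable_const.sub measurable_id).inv).ennreal_ofReal
  rw [setLIntegral_congr_fun measurableSet_Ioo (fun t ht => iSup_enorm_curl_selfSimilar ht.2 ubar),
    lintegral_mul_const _ hmeas, lintegral_inv_sub_eq_top hT, ENNReal.top_mul hω]

end StepFour

/-! ## The period bridge of the Clay delta (rev 3): `PeriodScalingBridge` is a theorem -/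

/-- **The «period 2π vs period 1» half of the typed Clay delta is a THEOREM** (lit-4's bridge file
`Literature/Claims/NS/ClayPeriodScalingBridge.lean`, p467118: parabolic rescaling of unforced smooth
periodic data keeps `ν`, Tao 2013 Rem. 1.2): an unforced smooth `2π`-periodic divergence-free datum with
no global printed-class solution refutes Clay-(B)-regularity at the same `ν`. Hence `ClayDelta` reduces to
`ContinuationBridge` alone (`clayDelta_of_continuationBridge`). [cite: Shahmurov2026b, Thm 2.1 p.2 and Thm 13.2 eq. (13.1) p.10] [cite: Tao2013Localisation, Rem. 1.2] -/
theorem periodScalingBridge_holds : PeriodScalingBridge := by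
  intro ν _hν h
  obtain ⟨u₀, hu₀, hdiv, hper, hno⟩ := h
  exact Literature.Claims.NS.ClayVariants.not_clayPeriodic_regularityAt_of_period Real.two_pi_pos hu₀
    hdiv hper hno

/-- `ClayDelta` shrinks to the continuation bridge (uniqueness-up-to-Galilean-boost of smooth periodic
solutions on `[0,T*)`, Tao 2013 Prop. 1.7 — classical, not in the tree). [cite: Shahmurov2026b, Thm 2.1 p.2] -/
theorem clayDelta_of_continuationBridge (h : ContinuationBridge) : ClayDelta :=
  ⟨h, periodScalingBridge_holds⟩

end Shahmurov2026b

end Summit.NavierStokesRegularity.NavierStokesRegularity.Theorems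

end
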